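import Summits.QuantumFields.YangMills.Theorems.FluctuationComparisonRegPrIntLRunPairOrganRunWindowTailsEngine
import Summits.QuantumFields.YangMills.Theorems.FirstExitWindowOneStepWindowL
import HarnessLib

/-!
# Crux `FluctuationComparisonRegPrIntL` (stmt-QuantumFields-20520), LINE «run-pair organ» (ym-r3-idea-1, skeleton v8) — stub S1b
# `RunWindowTails`, part 2/2: THE DOOR `FirstExitWindowTailL → RunWindowTailsL` (S1b PER BLOCK SIZE from crux 26243)

§5 sums the explicit profile of part 1 under its weighted geometric majorant (`tsum_shift_le_of_le_geometric`) and packages the ENGINE: for one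
family and one coupling, the window and the first-exit tail give a floor-class profile `η` (`Σ η < ∞`, `Σ_i Σ'_k η(k+i) < ∞`,
`(Σ'_k η(k+j))·(1 + 2β_j#Plaq_j)#PBond_j² → 0`) with `Gibbs_K{Ū^{K−j} not θ(j)-small} ≤ η j` for all `K ≥ j`.  §6 states S1b PER BLOCK SIZE
(`RunWindowTailsL`: the skeleton's `RunWindowTails` with `∀ (L : ℕ)` after the exponent threshold and `F.L = L →` after `∀ F γ` — the typing of
every neighbouring R3 crux and of Bałaban's fixed-`L` theorems) and proves the DOOR
`runWindowTailsL_of_firstExitWindowTailL : FirstExitWindow.FirstExitWindowTailL → RunWindowTailsL` (crux stmt-QuantumFields-26243 BY NAME;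
the window `OneStepWindowL`, item 26244, is the landed `firstExitWindow_oneStepWindowL_proof`), with `pT := 3`.

WHY PER BLOCK SIZE: 26243 and 26244 deliver `γ₁(L, b₀, p₀, b₂)`; an `L`-uniform threshold (the skeleton's v5–v8 typing `∃ γ₁ … ∀ F`) cannot be
extracted from them.  The leaf does not need `L`-uniformity: `UnitScaleTilt.closes` reaches `YM3TorusSU2` (γ₁ := 1) from per-`L` cruxes by the
refinement trick (`T3ThresholdRemoval.continuumYM3Torus_of_refine`), so a per-`L` re-typing of the run-pair organ's stubs loses nothing; with it,
`stub_runWindowTails := runWindowTailsL_of_firstExitWindowTailL stub_firstExitWindowTail` closes S1b by name modulo 26243.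

Width seat `ym-line-sfw-p2-w3` g32 (cell `ym-idea-1`, R3 family; free hands).  HONEST FRAMING: a conditional door; 26243 (organ-class, XL, its own
two lines) is NOT proved; no crux, rung or summit is proved; `YM3TorusSU2` and the Yang–Mills mass gap are NOT proved.  R3 is a RECORD rung.
-/

noncomputable section

set_option autoImplicit false

open MeasureTheory Filter Topology
open Literature.MathematicalPhysics.QuantumFieldTheory.Balaban1983to89
open Literature.MathematicalPhysics.QuantumFieldTheory.Balaban1983to89.T3ContinuumYM3Torus
open Literature.MathematicalPhysics.QuantumFieldTheory.Balaban1983to89.T3NestedUnitLaws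
open Literature.MathematicalPhysics.QuantumFieldTheory.Balaban1983to89.T3UnitScaleTilt
open Literature.MathematicalPhysics.QuantumFieldTheory.Balaban1983to89.T3UnitLawDensityEML (ℰp measurableE_ℰp)
open Summit.QuantumFields.YangMills.Theorems.HistoryTailOfTwoSided
open Summit.QuantumFields.YangMills.Theorems.LargeFieldMassRefinementTailOfFirstExit

namespace Summit.QuantumFields.YangMills.Theorems.FluctuationComparisonRegPrIntL.RunPairOrgan.RunWindowTailsDoor

variable (F : T3Family)

/-! ## §5 Tails of a geometrically dominated profile, and the engine -/

/-- TAILS UNDER A WEIGHTED GEOMETRIC MAJORANT: if `0 ≤ f n ≤ M·2^{−n}/V n` with `V ≥ 1` monotone, then the tail from `j` is summable and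
`Σ'_k f(k + j) ≤ 2M·2^{−j}/V j`. [folklore] -/
theorem tsum_shift_le_of_le_geometric {f V : ℕ → ℝ} {M : ℝ} (hM : 0 ≤ M) (hV1 : ∀ n, 1 ≤ V n) (hVmono : Monotone V)
    (hf0 : ∀ n, 0 ≤ f n) (hf : ∀ n, f n ≤ M * ((1 : ℝ) / 2) ^ n / V n) (j : ℕ) :
    Summable (fun k => f (k + j)) ∧ ∑' k, f (k + j) ≤ 2 * M * ((1 : ℝ) / 2) ^ j / V j := by
  have hVj : 0 < V j := one_pos.trans_le (hV1 j)
  set g : ℕ → ℝ := fun k => (M * ((1 : ℝ) / 2) ^ j / V j) * ((1 : ℝ) / 2) ^ k with hg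
  have hfg : ∀ k, f (k + j) ≤ g k := by
    intro k
    refine (hf (k + j)).trans ?_
    have hVle : V j ≤ V (k + j) := hVmono (Nat.le_add_left j k)
    calc M * ((1 : ℝ) / 2) ^ (k + j) / V (k + j) ≤ M * ((1 : ℝ) / 2) ^ (k + j) / V j :=
          div_le_div_of_nonneg_left (by positivity) hVj hVle
      _ = g k := by rw [hg, pow_add]; ring
  have hgs : Summable g := summable_geometric_two.mul_left _
  have hfs : Summable (fun k => f (k + j)) := Summable.of_nonneg_of_le (fun k => hf0 _) hfg hgs
  refine ⟨hfs, ?_⟩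
  calc ∑' k, f (k + j) ≤ ∑' k, g k := hfs.tsum_le_tsum hfg hgs
    _ = (M * ((1 : ℝ) / 2) ^ j / V j) * 2 := by rw [hg, tsum_mul_left, tsum_geometric_two]
    _ = 2 * M * ((1 : ℝ) / 2) ^ j / V j := by ring

/-- **THE RUN-WINDOW-TAILS ENGINE** (one family, one coupling `0 < γ ≤ 1`, profile `0 < b₀`, `1 ≤ p₀`): the one-step WINDOW
(`θ_{b₀}`-small `Ū^{j}` ⇒ `θ_{b₂}`-small `Ū^{j+1}`, every `j + 1 ≤ K`, every configuration) and the FIRST-EXIT TAIL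
(`Gibbs_K(FE(K, j, p)) ≤ C₀·β_{K−j}^N·e^{−c₀ p(g_{K−j})²}`, `c₀ > 0`) give a height profile `η ≥ 0` in the FLOOR CLASS — `Σ η < ∞`,
`Σ_i Σ'_k η(k+i) < ∞`, `(Σ'_k η(k+j))·(1 + 2β_j#Plaq_j)#PBond_j² → 0` — with `Gibbs_K{Ū^{K−j} not θ_{b₀}(j)-small} ≤ η j` for ALL runs
`K ≥ j`: least-bad-height decomposition, the landed bare tail, the explicit profile and its geometric majorant. [cite: Balaban1985UV3, (7) p.257 and (71) p.273] -/
theorem engine {γ b₀ b₂ p₀ C₀ c₀ : ℝ} {N : ℕ} (hγ : 0 < γ) (hγ1 : γ ≤ 1) (hb₀ : 0 < b₀) (hp₀ : 1 ≤ p₀) (hc₀ : 0 < c₀)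
    (hW : ∀ K j : ℕ, j + 1 ≤ K → ∀ U : GaugeField (F.P K) 0 (Matrix.specialUnitaryGroup (Fin 2) ℂ),
      PlaqSmall (θBal F.L γ b₀ p₀ (K - j))
          (Averaging.iter (fun i => BlockAveraging.blockAvg (P := F.P K) (j := i) ℰp) j U) →
        PlaqSmall (θBal F.L γ b₂ p₀ (K - (j + 1)))
          (Averaging.iter (fun i => BlockAveraging.blockAvg (P := F.P K) (j := i) ℰp) (j + 1) U))
    (hFE : ∀ K j : ℕ, 1 ≤ j → j ≤ K → ∀ p : Plaq (F.P K) j, (gibbsK F ℰp γ K).real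
      {U | (∀ k, k < j → PlaqSmall (θBal F.L γ b₀ p₀ (K - k))
          (Averaging.iter (fun i => BlockAveraging.blockAvg (P := F.P K) (j := i) ℰp) k U)) ∧
        PlaqSmall (θBal F.L γ b₂ p₀ (K - j))
          (Averaging.iter (fun i => BlockAveraging.blockAvg (P := F.P K) (j := i) ℰp) j U) ∧
        θBal F.L γ b₀ p₀ (K - j) ≤ GaugeGroup.dist1 (GaugeField.plaqHol
          (Averaging.iter (fun i => BlockAveraging.blockAvg (P := F.P K) (j := i) ℰp) j U) p)} ≤
      C₀ * ((γ * ((F.L : ℝ)⁻¹) ^ (K - j))⁻¹) ^ N *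
        Real.exp (-(c₀ * B10.pFun b₀ p₀ (Real.sqrt (γ * ((F.L : ℝ)⁻¹) ^ (K - j))) ^ 2))) :
    ∃ η : ℕ → ℝ, (∀ j, 0 ≤ η j) ∧ Summable η ∧ Summable (fun i => ∑' k, η (k + i)) ∧
      Tendsto (fun j => (∑' k, η (k + j)) * weight F γ j) atTop (𝓝 0) ∧
      ∀ K j : ℕ, j ≤ K → (gibbsK F ℰp γ K).real {U | ¬ PlaqSmall (θBal F.L γ b₀ p₀ j)
        (Averaging.iter (fun i' => BlockAveraging.blockAvg (P := F.P K) (j := i') ℰp) (K - j) U)} ≤ η j := by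
  -- constants: the bare tail's `cb`, the unified `C, A, c`, the weight constant `Cw`
  obtain ⟨cb, hcb, -, Hb⟩ := T3FinestHeightTail.gibbsK_real_not_plaqSmall_le
  set C : ℝ := 2 * Real.exp 24 * (cb ^ 3)⁻¹ + max C₀ 0 with hCdef
  set A : ℕ := max N 5 with hAdef
  set c : ℝ := min c₀ (1 / 4) with hcdef
  have hC0 : 0 ≤ C := by positivity
  have hc : 0 < c := lt_min hc₀ (by norm_num)
  set Cw : ℝ := 145 * 72 ^ 2 * (F.L : ℝ) ^ (9 * F.m) with hCwdef
  have hL1 : (1 : ℝ) ≤ F.L := by exact_mod_cast F.hL.2.le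
  have hCw1 : 1 ≤ Cw := by
    have : (1 : ℝ) ≤ (F.L : ℝ) ^ (9 * F.m) := one_le_pow₀ hL1
    rw [hCwdef]; nlinarith
  -- the profile and its properties
  set f : ℕ → ℝ := profile F γ b₀ p₀ C A c with hfdef
  have hf0 : ∀ h, 0 ≤ f h := fun h => profile_nonneg F hγ.le hC0 A c h
  have hbare : ∀ K, (gibbsK F ℰp γ K).real {U | ¬ PlaqSmall (θBal F.L γ b₀ p₀ K) U} ≤ f K :=
    fun K => bare_le_profile F hγ hγ1 hb₀.le (Hb F γ hγ b₀ p₀) hcb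
      (le_add_of_nonneg_right (le_max_right _ _)) (le_max_right _ _) (min_le_right _ _) K
  have hfb := fun K i (hi : 1 ≤ i) (hiK : i ≤ K) =>
    finestBad_le_profile F hγ hγ1 hW hFE (C := C) (A := A) (c := c)
      (le_add_of_nonneg_left (by positivity)) (le_max_left _ _) (min_le_left _ _) K i hi hiK
  -- the weighted majorant `V h · f h ≤ M 2^{-h}`, `V h = Cw β_h^{10} ≥ weight h`, `V ≥ 1` monotone
  set V : ℕ → ℝ := fun h => Cw * (F.scheme ℰp γ).β h ^ 10 with hVdef
  obtain ⟨M, hM0, hM⟩ := weighted_profile_le F (A := A) hγ hγ1 hb₀ hp₀ hC0 hc (zero_le_one.trans hCw1)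
  have hV1 : ∀ h, 1 ≤ V h := fun h => by
    have hβ1 := (pow_le_schemeβ F hγ hγ1 h).2
    have : (1 : ℝ) ≤ (F.scheme ℰp γ).β h ^ 10 := one_le_pow₀ hβ1
    rw [hVdef]; nlinarith
  have hVmono : Monotone V := by
    intro h h' hle
    have hL0 : (0 : ℝ) < F.L := one_pos.trans_le hL1
    have hβle : (F.scheme ℰp γ).β h ≤ (F.scheme ℰp γ).β h' := by
      rw [show (F.scheme ℰp γ).β h = (γ * ((F.L : ℝ)⁻¹) ^ h)⁻¹ from rfl,
        show (F.scheme ℰp γ).β h' = (γ * ((F.L : ℝ)⁻¹) ^ h')⁻¹ from rfl, inv_pow, mul_inv, inv_inv, inv_pow, mul_inv, inv_inv]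
      exact mul_le_mul_of_nonneg_left (pow_le_pow_right₀ hL1 hle) (inv_nonneg.mpr hγ.le)
    have hβ0 : 0 ≤ (F.scheme ℰp γ).β h := F.scheme_β_nonneg ℰp hγ.le h
    show Cw * (F.scheme ℰp γ).β h ^ 10 ≤ Cw * (F.scheme ℰp γ).β h' ^ 10
    exact mul_le_mul_of_nonneg_left (pow_le_pow_left₀ hβ0 hβle 10) (zero_le_one.trans hCw1)
  have hW_le : ∀ h, weight F γ h ≤ V h := fun h => weight_le F hγ hγ1 h
  have hfM : ∀ h, f h ≤ M * ((1 : ℝ) / 2) ^ h / V h := fun h => by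
    rw [le_div_iff₀ (one_pos.trans_le (hV1 h)), mul_comm]
    exact hM h
  -- the tails `η j = Σ'_k f(k + j)`
  refine ⟨fun j => ∑' k, f (k + j), fun j => tsum_nonneg fun k => hf0 _, ?_, ?_, ?_, ?_⟩
  · -- `Summable η`
    have hη : ∀ j, ∑' k, f (k + j) ≤ (2 * M) * ((1 : ℝ) / 2) ^ j := fun j => by
      have h := (tsum_shift_le_of_le_geometric hM0 hV1 hVmono hf0 hfM j).2
      refine h.trans ?_
      rw [div_le_iff₀ (one_pos.trans_le (hV1 j))]
      have : 0 ≤ 2 * M * ((1 : ℝ) / 2) ^ j := by positivity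
      nlinarith [hV1 j]
    exact Summable.of_nonneg_of_le (fun j => tsum_nonneg fun k => hf0 _) hη (summable_geometric_two.mul_left _)
  · -- `Summable (i ↦ Σ'_k η(k + i))`
    have hη : ∀ n, ∑' k, f (k + n) ≤ (2 * M) * ((1 : ℝ) / 2) ^ n / V n := fun n =>
      (tsum_shift_le_of_le_geometric hM0 hV1 hVmono hf0 hfM n).2
    have h2 : ∀ i, ∑' k, (∑' l, f (l + (k + i))) ≤ (4 * M) * ((1 : ℝ) / 2) ^ i := fun i => by
      have h := (tsum_shift_le_of_le_geometric (f := fun n => ∑' l, f (l + n)) (by positivity) hV1 hVmono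
        (fun n => tsum_nonneg fun l => hf0 _) hη i).2
      refine h.trans ?_
      rw [div_le_iff₀ (one_pos.trans_le (hV1 i))]
      have : 0 ≤ 4 * M * ((1 : ℝ) / 2) ^ i := by positivity
      nlinarith [hV1 i]
    exact Summable.of_nonneg_of_le (fun i => tsum_nonneg fun k => tsum_nonneg fun l => hf0 _) h2
      (summable_geometric_two.mul_left _)
  · -- the floor-class `Tendsto`
    have hη : ∀ n, ∑' k, f (k + n) ≤ (2 * M) * ((1 : ℝ) / 2) ^ n / V n := fun n =>
      (tsum_shift_le_of_le_geometric hM0 hV1 hVmono hf0 hfM n).2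
    have h2 : ∀ j, (∑' k, (∑' l, f (l + (k + j)))) * weight F γ j ≤ (4 * M) * ((1 : ℝ) / 2) ^ j := fun j => by
      have h := (tsum_shift_le_of_le_geometric (f := fun n => ∑' l, f (l + n)) (by positivity) hV1 hVmono
        (fun n => tsum_nonneg fun l => hf0 _) hη j).2
      have hVj : 0 < V j := one_pos.trans_le (hV1 j)
      calc (∑' k, (∑' l, f (l + (k + j)))) * weight F γ j
          ≤ (2 * (2 * M) * ((1 : ℝ) / 2) ^ j / V j) * V j :=
            mul_le_mul h (hW_le j) (weight_nonneg F hγ.le j) (by positivity)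
        _ = (4 * M) * ((1 : ℝ) / 2) ^ j := by field_simp; ring
    have hlim : Tendsto (fun j : ℕ => (4 * M) * ((1 : ℝ) / 2) ^ j) atTop (𝓝 0) := by
      have h := (tendsto_pow_atTop_nhds_zero_of_lt_one (by norm_num : (0 : ℝ) ≤ 1 / 2)
        (by norm_num : (1 : ℝ) / 2 < 1)).const_mul (4 * M)
      rw [mul_zero] at h
      exact h
    exact squeeze_zero (fun j => mul_nonneg (tsum_nonneg fun k => tsum_nonneg fun l => hf0 _) (weight_nonneg F hγ.le j))
      h2 hlim
  · -- the per-run bound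
    intro K j hjK
    have hfs : Summable f := by
      have h := (tsum_shift_le_of_le_geometric hM0 hV1 hVmono hf0 hfM 0).1
      simpa using h
    exact real_badHeight_le_tsum F hγ.le hC0 hfs hbare hfb hjK


/-! ## §6 S1b in its PER-BLOCK-SIZE form, from the first-exit window tail of route `FirstExitWindow` -/

/-- **`RunWindowTailsL` — S1b `RunWindowTails` of the run-pair organ skeleton RE-TYPED PER BLOCK SIZE**: byte-identical to the skeleton's
`RunWindowTails` except that the coupling threshold `γ₁` may depend on the block size — `∀ (L : ℕ)` is inserted after the exponent
threshold `pT` and `F.L = L →` after `∀ F γ`, exactly as in every neighbouring R3 crux (UnitScaleTilt's 19936/19200/20520, FirstExitWindow's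
26243, SmallFieldWidening's 22884) and as Bałaban's theorems are printed (fixed `L`, [Balaban1987RG1] §0 p.251).  Per block size: for
`p₀ ≥ pT` and `b₀ > 0` there is `γ₁(L, b₀, p₀) > 0` such that every family of block size `L` at every `0 < γ ≤ γ₁` has a floor-class tails
profile `η` bounding the window complements of all its nested cut-off laws, uniformly in the cut-off (route-posited statement; the
large-field input is Bałaban, CMP 102 (1985) (7) p.257 and (71) p.273 — deliberately NOT a cite-tagged fact: this is a stub shape, not a
printed theorem). -/
def RunWindowTailsL : Prop :=
  ∃ pT : ℝ, 0 < pT ∧ ∀ (L : ℕ) (b₀ p₀ : ℝ), 0 < b₀ → pT ≤ p₀ → ∃ γ₁ : ℝ, 0 < γ₁ ∧ ∀ (F : T3Family) (γ : ℝ), F.L = L → 0 < γ → γ ≤ γ₁ →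
    ∃ η : ℕ → ℝ, (∀ j, 0 ≤ η j) ∧ Summable η ∧
      Summable (fun i => ∑' k, η (k + i)) ∧ Tendsto (fun j => (∑' k, η (k + j)) * ((1 + 2 * ((F.L : ℝ) ^ j / γ) * (Fintype.card (Plaq (F.P j) 0) : ℝ)) * (Fintype.card (PBond (F.P j) 0) : ℝ) ^ 2)) atTop (𝓝 0) ∧
      ∀ (ν : ℕ → (j : ℕ) → Measure (GaugeField (F.P j) 0 (Matrix.specialUnitaryGroup (Fin 2) ℂ))),
        (∀ K, ν K K = T4GenFunBounds.gibbsMeasure (F.P K) ((F.scheme ℰp γ).β K)) →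
        (∀ K j, j < K → ν K j = Measure.map (descend F ℰp j) (ν K (j + 1))) →
        ∀ (K j : ℕ), j ≤ K → ν K j {U | ¬ PlaqSmall (θBal F.L γ b₀ p₀ j) U} ≤ ENNReal.ofReal (η j)

/-- **THE DOOR: `OneStepWindowL → FirstExitWindowTailL → RunWindowTailsL`** (route `FirstExitWindow`'s support 26244 and crux 26243 ⇒
per-block-size S1b) with `pT := 3`, `γ₁ := min γ_W γ_F`: the engine of §5 on the window and the first-exit tail at `(L, b₀, p₀, b₂)`, read on the
nested laws by §1. [cite: Balaban1985UV3, (7) p.257 and (71) p.273] -/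
theorem runWindowTailsL_of_window_firstExit
    (hW : Summit.QuantumFields.YangMills.Theses.FirstExitWindow.OneStepWindowL)
    (hF : Summit.QuantumFields.YangMills.Theses.FirstExitWindow.FirstExitWindowTailL) :
    RunWindowTailsL := by
  refine ⟨3, by norm_num, ?_⟩
  intro L b₀ p₀ hb₀ hp₀
  obtain ⟨b₂, γW, hb₂, hγW, hγW1, hWF⟩ := hW L b₀ p₀ hb₀ (by linarith)
  obtain ⟨γF, C₀, c₀, N, hγF, -, hc₀, hFF⟩ := hF L b₀ p₀ b₂ hb₀ (by linarith) hb₂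
  refine ⟨min γW γF, lt_min hγW hγF, ?_⟩
  intro F γ hFL hγ hγle
  have hγW' : γ ≤ γW := hγle.trans (min_le_left _ _)
  have hγF' : γ ≤ γF := hγle.trans (min_le_right _ _)
  have hγ1 : γ ≤ 1 := hγW'.trans hγW1
  obtain ⟨η, hη0, hηs, hηs2, hηt, Hη⟩ :=
    engine F hγ hγ1 hb₀ (by linarith) hc₀ (hWF F γ hFL hγ hγW') (hFF F γ hFL hγ hγF')
  refine ⟨η, hη0, hηs, hηs2, hηt, ?_⟩
  intro ν hν1 hν2 K j hjK
  haveI := isProbabilityMeasure_gibbsK F ℰp hγ.le K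
  rw [nestedLaw_not_plaqSmall_eq F ν hν1 hν2 _ hjK, ← ofReal_measureReal (measure_ne_top _ _)]
  exact ENNReal.ofReal_le_ofReal (Hη K j hjK)

/-- **S1b (per block size) FROM THE FIRST-EXIT WINDOW TAIL ALONE**: the window `OneStepWindowL` is a tree theorem
(`firstExitWindow_oneStepWindowL_proof`, item 26244 CLOSED), so `FirstExitWindowTailL` (crux stmt-QuantumFields-26243, BY NAME) implies
`RunWindowTailsL`. [cite: Balaban1985UV3, (7) p.257 and (71) p.273] -/
theorem runWindowTailsL_of_firstExitWindowTailL
    (hF : Summit.QuantumFields.YangMills.Theses.FirstExitWindow.FirstExitWindowTailL) : RunWindowTailsL :=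
  runWindowTailsL_of_window_firstExit Summit.QuantumFields.YangMills.Theorems.firstExitWindow_oneStepWindowL_proof hF
end Summit.QuantumFields.YangMills.Theorems.FluctuationComparisonRegPrIntL.RunPairOrgan.RunWindowTailsDoor
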